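import Literature.AnabelianGeometry.EtaleTheta.Discharge.Sec2TemperedCoverDataModel
import HarnessLib

/-!
# [EtTh] Prop 2.4's extension predicate (`ExtendsStabilising`) and Cor 2.9's last sentence
# (`Cor29_preserved`) at the NV-L2 model of `ThetaCovers.TemperedCoverData`
# (FACT-LIST rows F-0603, F-0601 — schema / vocabulary rows; F-0600 cross-reference)

S. Mochizuki, *The étale theta function and its Frobenioid-theoretic manifestations*, Publ. RIMS **45**
(2009) [MochizukiEtTh2009], §2: Prop 2.4 p.38 ("`γ` induces isomorphisms compatible with the various
natural maps between the respective `Π^tp`'s"), Cor 2.9 p.43 ("these bijections are preserved by arbitrary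
isomorphisms `γ` as in Corollary 2.8").  abc-iut cell, block F (fact-proving wave), seat abc-iut-f-142,
tranche 142 of `plan/F-TRANCHES.tsv` (trunk `ThetaCoversTempered.lean`, abc-iut-L2-t2).  PROOF-ONLY
companion (0 definitions); the typed statements are imported, never edited; the model is abc-iut-w5-d118's
(«Heisenberg ⋊ D_l × Tate ℤ ⊆ Ẑ», `G_K = 1`; `ThetaCoversTemperedModelDefs.lean`,
`Discharge/Sec2TemperedCoverDataModel{Theta,}.lean`) — its structure literal (the one of
`TemperedModel.exists_model`) is re-assembled below from its public lemmas, nothing restated as a definition.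

WHAT IS PROVED.
* Over the interface (pure group theory): `extendsStabilising_refl` (the identity always extends — the
  predicate is satisfiable at every `T`, `H`, `L`); `natCard_cuspOrbits_of_cuspStabC_eq_top`,
  `cor29_preserved_of_cuspStabC_eq_top`, `not_cor29_card_of_cuspStabC_eq_top`: when the cusp stabiliser
  `N_{Π^tp_C}(tp D_x)` is ALL of `Π^tp_C` (degenerate `D_x`), every member has ONE `Aut_K`-orbit of cusps, so
  the typed `Cor29_preserved` holds TRIVIALLY while the typed `Cor29_card` fails for `l ≥ 3`.
* At the model (`exists_model_automorphisms`): `K ⊇ μ_l`, `cuspStabC = ⊤`, hence `T.Cor29_preserved` HOLDS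
  and `¬ T.Cor29_card` (the latter = abc-iut-w5-d118's `not_forall_cor29_card`, F-0600); and the automorphism
  `(a, n) ↦ (a, -n)` of `Π^tp_C = A × ℤ` (identity on the finite factor, inversion on the Tate factor),
  viewed on `H = ⊤`, admits NO extension stabilising the cyclic subgroup generated by `((r¹, 1), 1)`
  (its image `((r¹, 1), -1)` is not a power of it, as `r¹ ≠ r⁻¹` in `D_l`, `l ≥ 3`).
* Schema verdicts: `not_forall_extendsStabilising` (F-0603: the universal closure of the VOCABULARY
  predicate `ExtendsStabilising` over `(T, H, γ, L)` is false, as expected of a predicate consumed BY NAME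
  inside `Prop24`/`Prop26`); F-0601 `Cor29_preserved` is CONSISTENT with the interface + `HasMuL` (holds at
  the model, degenerate reason) — its universal closure is NOT decided here (a counter-model needs a
  non-normal `D_x`, i.e. a non-central `Δ̄_Θ`-preimage, which this model does not have).

READING (honest label).  CONSISTENCY / INDEPENDENCE certificates on the typed interface only; no claim
about the printed Prop 2.4 / Cor 2.9.  no side taken on [IUTchIII] Cor 3.12; typed ≠ proved.
-/

noncomputable section

namespace Literature.AnabelianGeometry.EtaleTheta

namespace ThetaCovers

universe u

namespace TemperedCoverData

variable {l : ℕ} (T : TemperedCoverData.{u} l)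

/-- **The identity always extends**: `ExtendsStabilising H (refl H) L` holds for every `H`, `L` (take
`Γ = refl`).  The Prop 2.4 predicate is thus satisfiable everywhere; its content is in WHICH `γ` it is
asserted for. [cite: MochizukiEtTh2009, Prop 2.4 p.38] -/
theorem extendsStabilising_refl (H : Subgroup T.Gtp) (L : List (Subgroup T.Gtp)) :
    T.ExtendsStabilising H (ContinuousMulEquiv.refl H) L := by
  refine ⟨ContinuousMulEquiv.refl T.Gtp, fun _ => rfl, fun S _ => ?_⟩
  exact Subgroup.map_id S

/-- **Degenerate cusp stabiliser ⇒ one orbit**: if `N_{Π^tp_C}(tp D_x) = Π^tp_C` then every double-coset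
space `N(S) \ Π^tp_C / cuspStabC` is a point. (Pure group theory; the computation of abc-iut-w5-d118's
`exists_model` (5), stated over the interface.) [cite: MochizukiEtTh2009, Cor 2.9 p.43] -/
theorem natCard_cuspOrbits_of_cuspStabC_eq_top (h : T.cuspStabC = ⊤) (S : Subgroup T.Gtp) :
    Nat.card (T.cuspOrbits S) = 1 := by
  haveI : Subsingleton (T.cuspOrbits S) := by
    refine ⟨fun a b => ?_⟩
    induction a using Quotient.inductionOn with
    | _ a =>
      induction b using Quotient.inductionOn with
      | _ b =>
        refine (DoubleCoset.eq _ _ a b).mpr ⟨1, Subgroup.one_mem _, a⁻¹ * b, ?_, by group⟩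
        rw [h]
        trivial
  exact Nat.card_unique

/-- **Degenerate cusp stabiliser ⇒ the typed `Cor29_preserved` holds trivially**: with one double coset
`N(S) \ Π^tp_C / Π^tp_C`, every `Γ` acts trivially on the orbit space. [cite: MochizukiEtTh2009, Cor 2.9 p.43] -/
theorem cor29_preserved_of_cuspStabC_eq_top (h : T.cuspStabC = ⊤) : T.Cor29_preserved := by
  intro _ p _ Γ _ _ g
  refine (DoubleCoset.eq _ _ _ _).mpr ⟨1, Subgroup.one_mem _, (Γ g)⁻¹ * g, ?_, by group⟩
  rw [h]
  trivial

/-- **Degenerate cusp stabiliser + `K ⊇ μ_l` ⇒ the typed `Cor29_card` FAILS for `l ≥ 3`** (one orbit, but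
`#(ℤ/lℤ)^± = (l+1)/2 ≥ 2`). [cite: MochizukiEtTh2009, Cor 2.9 p.43] -/
theorem not_cor29_card_of_cuspStabC_eq_top (hμ : T.HasMuL) (h : T.cuspStabC = ⊤) (h3 : 3 ≤ l) :
    ¬ T.Cor29_card := by
  intro hc
  have h2 := hc hμ (T.tp T.PiCu) (by simp)
  rw [T.natCard_cuspOrbits_of_cuspStabC_eq_top h] at h2
  omega

end TemperedCoverData

namespace TemperedModel

open Multiplicative HeisenbergWitness Literature.AnabelianGeometry.SemiGraphs
  Literature.AnabelianGeometry.EtaleTheta.SettingModel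

variable (l : ℕ) [NeZero l]

omit [NeZero l] in
/-- In `A = heisPiC l × ℤ/2`, the element `(r¹, 1)` is NOT an involution when `l ≥ 3` (`r¹ ≠ r⁻¹` in
`D_l`). (toy bookkeeping) [cite: MochizukiEtTh2009, Def 2.5 p.39] -/
theorem rotOne_inv_ne (h3 : 3 ≤ l) :
    (TA.mk l (SemidirectProduct.inr (DihedralGroup.r 1)) 1)⁻¹ ≠
      TA.mk l (SemidirectProduct.inr (DihedralGroup.r 1)) 1 := by
  haveI : Fact (2 < l) := ⟨h3⟩
  intro h
  have h' := congrArg (fun a : TA l => (TA.heis l a).right) h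
  have e : TA.heis l (TA.mk l (SemidirectProduct.inr (DihedralGroup.r 1)) 1) =
      SemidirectProduct.inr (DihedralGroup.r 1) := rfl
  simp only [map_inv, SemidirectProduct.inv_right, e, SemidirectProduct.right_inr,
    DihedralGroup.inv_r, DihedralGroup.r.injEq] at h'
  exact ZMod.neg_one_ne_one h'

/-- **THE NV-L2 MODEL: automorphism and cusp-orbit data.**  For every odd `l ≥ 3` there is a
`T : ThetaCovers.TemperedCoverData l` (abc-iut-w5-d118's model, the structure literal of
`TemperedModel.exists_model`) with: `K ⊇ μ_l` (`HasMuL`); `cuspStabC = ⊤`; the typed `Cor29_preserved` TRUE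
(degenerate reason); the typed `Cor29_card` FALSE; and an automorphism `γ` of `H = ⊤ = Π^tp_C` — identity on
`A`, inversion on the Tate factor `ℤ` — together with the cyclic subgroup `S = ⟨((r¹, 1), 1)⟩` such that
`¬ T.ExtendsStabilising ⊤ γ [S]` (any extension equals `γ`, which sends the generator to `((r¹, 1), -1) ∉ S`).
CONSISTENCY/INDEPENDENCE certificate only. [cite: MochizukiEtTh2009, Prop 2.4 p.38] -/
theorem exists_model_automorphisms (hl : Odd l) (h3 : 3 ≤ l) : ∃ T : TemperedCoverData.{0} l,
    T.HasMuL ∧ T.cuspStabC = ⊤ ∧ T.Cor29_preserved ∧ ¬ T.Cor29_card ∧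
      ∃ (γ : (⊤ : Subgroup T.Gtp) ≃ₜ* (⊤ : Subgroup T.Gtp)) (S : Subgroup T.Gtp),
        ¬ T.ExtendsStabilising ⊤ γ [S] := by
  haveI := TAX_normal l
  haveI : ((TAX l).prod (⊥ : Subgroup (Multiplicative ℤ))).Normal := Subgroup.prod_normal _ _
  let T : TemperedCoverData.{0} l :=
    { toCoverDataAx := coverDataAx l hl
      PiCuu := PiCuuM l
      isTypeLTorsThetaPm := isTypeLTorsThetaPm_PiCuuM l hl
      isOpen_PiCuu' := isOpen_PiCuuM l
      Gtp := GtpM l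
      toHat := (toHatM l).toMonoidHom
      continuous_toHat := (toHatM l).continuous
      injective_toHat := toHatM_injective l
      isProfiniteCompletion_toHat := isProfiniteCompletion_prodMap_etaCont (TA l) (Multiplicative ℤ)
      PiYtp := (TAX l).prod ⊥
      PiYtp_le := by
        change (TAX l).prod ⊥ ≤ (PiXM l).comap (toHatM l).toMonoidHom
        rw [comap_toHatM_PiXM]
        exact Subgroup.prod_mono le_rfl bot_le
      PiYtp_normal := inferInstance
      isOpen_PiYtp := isOpen_discrete _
      quotZ := nonempty_quotZ l
      PiYddtp := ((TAX l ⊓ (TA.two l).ker)).prod ⊥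
      PiYddtp_le := Subgroup.prod_mono inf_le_left le_rfl
      isOpen_PiYddtp := isOpen_discrete _
      relIndex_PiYddtp := relIndex_PiYddtp l
      PiCdot := ((TA.two l).ker).prod ⊤
      index_PiCdot := index_PiCdot l
      isOpen_PiCdot := isOpen_discrete _
      PiCdot_ne := PiCdot_ne l }
  -- the cusp stabiliser is everything: `tp D_x` is normal (abc-iut-w5-d118)
  have hN : (T.tp T.Dx).Normal := by
    change ((barThetaM l).comap (toHatM l).toMonoidHom).Normal
    haveI := barThetaM_normal l
    exact Subgroup.Normal.comap inferInstance _
  have hstab : T.cuspStabC = ⊤ := Subgroup.normalizer_eq_top_iff.mpr hN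
  have hμ : T.HasMuL := fun c t ht => hasMuL_model l hl c ht
  -- the generator `g₀ = ((r¹, 1), 1)` and the automorphism `(a, n) ↦ (a, n⁻¹)`
  let a₀ : TA l := TA.mk l (SemidirectProduct.inr (DihedralGroup.r 1)) 1
  let g₀ : GtpM l := (a₀, Multiplicative.ofAdd (1 : ℤ))
  let γ₀ : GtpM l ≃* GtpM l :=
    MulEquiv.prodCongr (MulEquiv.refl (TA l)) (MulEquiv.inv (Multiplicative ℤ))
  have hγ₀ : γ₀ g₀ = (a₀, (Multiplicative.ofAdd (1 : ℤ))⁻¹) := rfl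
  let e : (⊤ : Subgroup (GtpM l)) ≃* (⊤ : Subgroup (GtpM l)) :=
    Subgroup.topEquiv.trans (γ₀.trans Subgroup.topEquiv.symm)
  let γ : (⊤ : Subgroup T.Gtp) ≃ₜ* (⊤ : Subgroup T.Gtp) :=
    { e with
      continuous_toFun := continuous_of_discreteTopology
      continuous_invFun := continuous_of_discreteTopology }
  have hγ : ∀ x : GtpM l, ((γ ⟨x, Subgroup.mem_top x⟩ : (⊤ : Subgroup T.Gtp)) : GtpM l) = γ₀ x :=
    fun _ => rfl
  refine ⟨T, hμ, hstab, T.cor29_preserved_of_cuspStabC_eq_top hstab,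
    T.not_cor29_card_of_cuspStabC_eq_top hμ hstab h3, γ, Subgroup.zpowers g₀, ?_⟩
  rintro ⟨Γ, hΓ, hL⟩
  have hΓg : Γ g₀ = γ₀ g₀ := by
    rw [← hγ g₀]
    exact hΓ ⟨g₀, Subgroup.mem_top g₀⟩
  have hS : (Subgroup.zpowers g₀).map Γ.toMulEquiv.toMonoidHom = Subgroup.zpowers g₀ :=
    hL _ (List.mem_singleton.mpr rfl)
  have hmem : Γ g₀ ∈ Subgroup.zpowers g₀ := by
    have h := Subgroup.mem_map_of_mem Γ.toMulEquiv.toMonoidHom (Subgroup.mem_zpowers g₀)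
    rw [hS] at h
    exact h
  rw [hΓg, hγ₀] at hmem
  obtain ⟨k, hk⟩ := Subgroup.mem_zpowers_iff.mp hmem
  -- second coordinates: `(ofAdd 1)^k = (ofAdd 1)⁻¹` forces `k = -1`
  have h2 : (Multiplicative.ofAdd (1 : ℤ)) ^ k = (Multiplicative.ofAdd (1 : ℤ))⁻¹ :=
    congrArg Prod.snd hk
  have hk1 : k = -1 := by
    rw [← ofAdd_zsmul, ← ofAdd_neg, smul_eq_mul, mul_one] at h2
    exact Multiplicative.ofAdd.injective h2
  -- first coordinates: `a₀^k = a₀`, i.e. `a₀⁻¹ = a₀`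
  have h1 : a₀ ^ k = a₀ := congrArg Prod.fst hk
  rw [hk1, zpow_neg_one] at h1
  exact rotOne_inv_ne l h3 h1

/-- **FACT-LIST F-0603 (`ExtendsStabilising`), SCHEMA VERDICT: the universal closure of the Prop 2.4
extension predicate over `(T, H, γ, L)` is FALSE** (`l` odd, `l ≥ 3`): at the NV-L2 model the inversion of
the Tate factor on `H = Π^tp_C` stabilises no extension of the cyclic subgroup `⟨((r¹,1),1)⟩`.  The
predicate is VOCABULARY (consumed BY NAME in `Prop24`, `Prop26`); `extendsStabilising_refl` is its trivially
true instance. [cite: MochizukiEtTh2009, Prop 2.4 p.38] -/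
theorem not_forall_extendsStabilising (hl : Odd l) (h3 : 3 ≤ l) :
    ¬ ∀ (T : TemperedCoverData.{0} l) (H : Subgroup T.Gtp) (γ : H ≃ₜ* H) (L : List (Subgroup T.Gtp)),
      T.ExtendsStabilising H γ L := by
  obtain ⟨T, -, -, -, -, γ, S, hT⟩ := exists_model_automorphisms l hl h3
  exact fun h => hT (h T ⊤ γ [S])

/-- The same at `l = 3`, closed form. [cite: MochizukiEtTh2009, Prop 2.4 p.38] -/
theorem not_forall_extendsStabilising_three :
    ¬ ∀ (T : TemperedCoverData.{0} 3) (H : Subgroup T.Gtp) (γ : H ≃ₜ* H) (L : List (Subgroup T.Gtp)),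
      T.ExtendsStabilising H γ L :=
  not_forall_extendsStabilising 3 ⟨1, rfl⟩ le_rfl

/-- **FACT-LIST F-0601 (`Cor29_preserved`), CONSISTENCY WITNESS: the typed last sentence of Cor 2.9 HOLDS
at a `TemperedCoverData` with `K ⊇ μ_l`** (`l` odd, `l ≥ 3`) — for the degenerate reason that the model's
cusp stabiliser is all of `Π^tp_C` — while the typed `Cor29_card` fails there.  So `Cor29_preserved` does
not imply `Cor29_card` over the interface, and no refutation of its universal closure can come from a model
with normal `D_x`. [cite: MochizukiEtTh2009, Cor 2.9 p.43] -/
theorem exists_model_cor29_preserved_not_cor29_card (hl : Odd l) (h3 : 3 ≤ l) :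
    ∃ T : TemperedCoverData.{0} l, T.HasMuL ∧ T.Cor29_preserved ∧ ¬ T.Cor29_card := by
  obtain ⟨T, hμ, -, hp, hc, -⟩ := exists_model_automorphisms l hl h3
  exact ⟨T, hμ, hp, hc⟩

/-- Hence the implication «`Cor29_preserved` ⇒ `Cor29_card`» FAILS over the interface (`l` odd, `l ≥ 3`).
[cite: MochizukiEtTh2009, Cor 2.9 p.43] -/
theorem not_forall_cor29_card_of_cor29_preserved (hl : Odd l) (h3 : 3 ≤ l) :
    ¬ ∀ T : TemperedCoverData.{0} l, T.HasMuL → T.Cor29_preserved → T.Cor29_card := by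
  obtain ⟨T, hμ, hp, hc⟩ := exists_model_cor29_preserved_not_cor29_card l hl h3
  exact fun h => hc (h T hμ hp)

end TemperedModel

end ThetaCovers

end Literature.AnabelianGeometry.EtaleTheta
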